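import Summits.QuantumFields.YangMills.Theorems.AlphaInputsT3ACv3TubeProfileBox
import HarnessLib

/-!
# `AlphaInputsT3ACv3TubeProfileCorner` — START v3.1 (S1′): **THE CORNER-ANCHORED (ONE-QUADRANT) TUBE PROFILE `betaC`** the LEAD asked for (★w1-19936 g2 02:53:00Z (ii) «one-quadrant tubes end for free at
# ∂Ω»): the spread density sits on the window `[0, 2r]²` CORNERED at the corner plaquette, the δ stays at the corner `(0,0)`; `curl β = δ₀⊗δ₀ − τ′⊗τ′` as before; EVERY modified bond touches the
# quadrant `Q₃ = {u_μ ≥ 1, u_ν ≥ 1}`; and, instead of three reflected copies, ONE sign-parametrised family `betaQB μ ν negμ negν r` anchored at any of the four quadrants with the SAME sign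
# convention `t = s + β` (`curlB (s + β) = −ρ`) — cell `ym3-torus`, width seat `ym-ust-19936-w2` (g2)

WHY (LEAD's START v3.1 (ii)): choosing the quadrant cell `q(e)` of an interior edge whose continuation beyond the `∂Ω`-endpoint is missing, and a profile all of whose modified bonds touch `q(e)`,
makes every plaquette that sees the tube end lie outside `plaqsIn 0 Ω` — nothing to fill at boundary vertices.  The symmetric profile of `…TubeProfile` (window `[−r, r]²`) touches all four
quadrants; this file re-anchors it.  1-D letters: `tauC r t = [0 ≤ t ≤ 2r]/(2r+1)`, `hstepC r t = Σ_{s∈[0,t)}(δ₀ − τ_C)(s) = [0 < t] − #{s ∈ [0,2r] : s < t}/(2r+1) = [1 ≤ t ≤ 2r]·(1 − t/(2r+1))`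
(`hstepC_succ_sub : h_C(t+1) − h_C(t) = δ₀(t) − τ_C(t)`); the mirrored letters `tauQ true r t = τ_C(−t)`, `hstepQ true r t = −h_C(1 − t)` satisfy the SAME difference identity, so
`β_X = −τ^{ε_μ}(x)·h^{ε_ν}(y)`, `β_Y = h^{ε_μ}(x)·δ₀(y)` has `curl = δ₀⊗δ₀ − τ^{ε_μ}⊗τ^{ε_ν}` for all four sign pairs (`curl_betaQ`, one `linear_combination`).
WHAT.  §1 `tauC`, `cntC`, `hstepC` (+ `_succ_sub`, support, `|·| ≤ 1`, `0 ≤ τ_C ≤ 1/(2r+1)`, `sum_tauC = 1`); §2 `tauQ`, `hstepQ` (sign-parametrised; `hstepQ_succ_sub`, supports, bounds); §3 on `ℤ²`: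
`betaQX`, `betaQY`, `rhoQ`, ★ `curl_betaQ`, supports, bounds, `rhoQ_nonneg`, `rhoQ_le`; §4 MODEL 1-FORMS: `betaQB μ ν negμ negν r` and the LEAD's ★ `betaC μ ν r := betaQB μ ν false false r`;
`curlB_betaQB = δ₀δ₀ − ρ_Q`, ★★ `curlB_stringInd_add_betaQB = −ρ_Q` (all four quadrants, `t = s + β`), longitudinal curls `0`, `abs_curlB_stringInd_add_betaQB_le (≤ 1/(2r+1)²)`, ★ `betaQB_touches`
(a modified bond has an endpoint in the anchoring quadrant `Q(negμ, negν)`, inequalities inline), `betaQB_window` (`|u_μ|, |u_ν| ≤ 2r` on modified bonds), the `betaC` readings (`curlB_stringInd_add_betaC`,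
`betaC_touches_Q3`, `betaC_window`), and the plaquette reading `dist1_plaqB_tubeU_stringInd_add_betaQB_le` (`≤ exp(‖F′‖/(2r+1)²) − 1`).
HONEST FRAMING.  Arithmetic on `ℤ`, `ℤ²`, `ℤ^d`; count-neutral helper toward the (FL) row of 2′∕2′χ (`--supports stmt-QuantumFields-19936`); (S5), (FL)∕`hLift`, the stub, the crux and the gap are
NOT claimed; registry untouched.  YM₃ on the three-torus is RUNG R3 of the programme, not the Clay problem.

References: T. Bałaban, Commun. Math. Phys. 102 (1985) 277–309 [Balaban1985Variational] ((11)–(14) pp.279–280); Commun. Math. Phys. 98 (1985) 17–51 [Balaban1985Averaging] ((8)–(9) p.18).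
-/

set_option autoImplicit false

noncomputable section

open scoped Matrix.Norms.L2Operator

namespace Summit.QuantumFields.YangMills.Theorems.TubeProfile

open Finset
open Literature.MathematicalPhysics.QuantumFieldTheory.Balaban1983to89
open Literature.MathematicalPhysics.QuantumFieldTheory.Balaban1983to89.T4AdjointCovarianceUnitary (lieSU)
open Summit.QuantumFields.YangMills.Theorems.ModelBox
open Summit.QuantumFields.YangMills.Theorems.TubeStart (stringInd tubeU curlB_stringInd stringInd_of_ne stringInd_add_e_of_ne curlB_eq_zero_of_longitudinal dist1_plaqB_tubeU_le
  plaqB_tubeU_eq_one)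

variable (r : ℕ)

/-! ## §1 Corner-anchored 1-D letters on the window `[0, 2r]` -/

/-- `τ_C(t) = [0 ≤ t ≤ 2r]/(2r+1)` (the symmetric `τ` translated by `r`). [folklore] -/
def tauC (t : ℤ) : ℝ := tau r (t - r)

/-- `cnt_C(t) = #{s ∈ [0, 2r] : s < t}`. [folklore] -/
def cntC (t : ℤ) : ℤ := cnt r (t - r)

/-- `h_C(t) = Σ_{s ∈ [0, t)} (δ₀ − τ_C)(s) = [0 < t] − cnt_C(t)/(2r+1)` — the δ stays at `0`, the window moves to `[0, 2r]`. [folklore] -/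
def hstepC (t : ℤ) : ℝ := (if 0 < t then (1 : ℝ) else 0) - (cntC r t : ℝ) * ((2 * (r : ℝ) + 1))⁻¹

/-- `τ_C` unfolded as an indicator. [folklore] -/
theorem tauC_eq (t : ℤ) : tauC r t = if 0 ≤ t ∧ t ≤ 2 * (r : ℤ) then ((2 * (r : ℝ) + 1))⁻¹ else 0 := by
  unfold tauC tau
  by_cases h : 0 ≤ t ∧ t ≤ 2 * (r : ℤ)
  · rw [if_pos h, if_pos (by omega)]
  · rw [if_neg h, if_neg (by omega)]

/-- **`h_C(t+1) − h_C(t) = δ₀(t) − τ_C(t)`.** [folklore] -/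
theorem hstepC_succ_sub (t : ℤ) : hstepC r (t + 1) - hstepC r t = delta0 t - tauC r t := by
  have hn := n_pos r
  have hc : ((cntC r (t + 1) : ℤ) : ℝ) - (cntC r t : ℝ) = if -(r : ℤ) ≤ t - r ∧ t - r ≤ r then 1 else 0 := by
    have h := cnt_succ_sub r (t - r)
    have e : t + 1 - (r : ℤ) = t - r + 1 := by ring
    unfold cntC; rw [e]
    split_ifs at h ⊢
    · exact_mod_cast h
    · exact_mod_cast h
  have hA : (if 0 < t + 1 then (1 : ℝ) else 0) - (if 0 < t then (1 : ℝ) else 0) = delta0 t := by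
    unfold delta0
    split_ifs <;> first | (exfalso; omega) | norm_num
  have hB : (((cntC r (t + 1) : ℤ) : ℝ) - (cntC r t : ℝ)) * ((2 * (r : ℝ) + 1))⁻¹ = tauC r t := by
    rw [hc]; unfold tauC tau
    split_ifs <;> simp
  unfold hstepC
  rw [← hA, ← hB]
  ring

/-- `h_C = 0` for `t ≤ 0`. [folklore] -/
theorem hstepC_eq_zero_of_le {t : ℤ} (ht : t ≤ 0) : hstepC r t = 0 := by
  unfold hstepC cntC
  rw [cnt_of_le r (by omega), if_neg (by omega)]
  simp

/-- `h_C = 0` for `2r < t`. [folklore] -/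
theorem hstepC_eq_zero_of_lt {t : ℤ} (ht : 2 * (r : ℤ) < t) : hstepC r t = 0 := by
  unfold hstepC cntC
  rw [cnt_of_lt r (by omega), if_pos (by omega)]
  have hn := n_pos r
  push_cast
  field_simp
  ring

/-- `|h_C| ≤ 1`. [folklore] -/
theorem abs_hstepC_le_one (t : ℤ) : |hstepC r t| ≤ 1 := by
  have hn := n_pos r
  obtain ⟨h0, h1⟩ := cnt_bounds r (t - r)
  have h0' : (0 : ℝ) ≤ (cntC r t : ℝ) := by unfold cntC; exact_mod_cast h0
  have h1' : ((cntC r t : ℤ) : ℝ) ≤ 2 * (r : ℝ) + 1 := by unfold cntC; exact_mod_cast h1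
  have hq0 : 0 ≤ (cntC r t : ℝ) * (2 * (r : ℝ) + 1)⁻¹ := by positivity
  have hq1 : (cntC r t : ℝ) * (2 * (r : ℝ) + 1)⁻¹ ≤ 1 := by
    rw [← div_eq_mul_inv, div_le_one hn]; exact h1'
  by_cases ht : 0 < t
  · unfold hstepC; rw [if_pos ht, abs_le]; constructor <;> linarith
  · rw [hstepC_eq_zero_of_le r (not_lt.mp ht), abs_zero]; exact zero_le_one

/-- `τ_C = 0` off `[0, 2r]`. [folklore] -/
theorem tauC_eq_zero {t : ℤ} (ht : t < 0 ∨ 2 * (r : ℤ) < t) : tauC r t = 0 := by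
  rw [tauC_eq, if_neg (by omega)]

/-- `0 ≤ τ_C`. [folklore] -/
theorem tauC_nonneg (t : ℤ) : 0 ≤ tauC r t := tau_nonneg r _
/-- `τ_C ≤ 1/(2r+1)`. [folklore] -/
theorem tauC_le (t : ℤ) : tauC r t ≤ ((2 * (r : ℝ) + 1))⁻¹ := tau_le r _

/-- **`Σ_{t ∈ [0, 2r]} τ_C(t) = 1`.** [folklore] -/
theorem sum_tauC : ∑ t ∈ Icc (0 : ℤ) (2 * r), tauC r t = 1 := by
  have hn := n_pos r
  have h : ∀ t ∈ Icc (0 : ℤ) (2 * r), tauC r t = ((2 * (r : ℝ) + 1))⁻¹ := fun t ht => by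
    rw [mem_Icc] at ht; rw [tauC_eq, if_pos ⟨ht.1, by exact_mod_cast ht.2⟩]
  rw [sum_congr rfl h, sum_const, Int.card_Icc, nsmul_eq_mul]
  have e : ((2 * (r : ℤ) + 1 - 0).toNat : ℝ) = 2 * (r : ℝ) + 1 := by
    have : (2 * (r : ℤ) + 1 - 0).toNat = 2 * r + 1 := by omega
    rw [this]; push_cast; ring
  rw [e, mul_inv_cancel₀ hn.ne']

/-! ## §2 Sign-parametrised letters (the four quadrants at once) -/

/-- `τ^{ε}`: `τ_C(t)` (`neg = false`, window `[0, 2r]`) or `τ_C(−t)` (`neg = true`, window `[−2r, 0]`). [folklore] -/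
def tauQ (neg : Bool) (t : ℤ) : ℝ := if neg then tauC r (-t) else tauC r t

/-- `h^{ε}`: `h_C(t)` (`neg = false`, support `[1, 2r]`) or `−h_C(1 − t)` (`neg = true`, support `[1 − 2r, 0]`); both satisfy `h(t+1) − h(t) = δ₀(t) − τ^{ε}(t)`. [folklore] -/
def hstepQ (neg : Bool) (t : ℤ) : ℝ := if neg then -hstepC r (1 - t) else hstepC r t

/-- **`h^{ε}(t+1) − h^{ε}(t) = δ₀(t) − τ^{ε}(t)` for both signs.** [folklore] -/
theorem hstepQ_succ_sub (neg : Bool) (t : ℤ) : hstepQ r neg (t + 1) - hstepQ r neg t = delta0 t - tauQ r neg t := by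
  cases neg
  · simp only [hstepQ, tauQ, Bool.false_eq_true, ↓reduceIte]; exact hstepC_succ_sub r t
  · simp only [hstepQ, tauQ, ↓reduceIte]
    have h := hstepC_succ_sub r (-t)
    have e1 : (1 : ℤ) - (t + 1) = -t := by ring
    have e2 : (1 : ℤ) - t = -t + 1 := by ring
    have hd : delta0 (-t) = delta0 t := by unfold delta0; split_ifs <;> first | rfl | omega
    rw [e1, e2, ← hd]
    linarith

/-- `|h^{ε}| ≤ 1`. [folklore] -/
theorem abs_hstepQ_le_one (neg : Bool) (t : ℤ) : |hstepQ r neg t| ≤ 1 := by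
  unfold hstepQ; split_ifs
  · rw [abs_neg]; exact abs_hstepC_le_one r _
  · exact abs_hstepC_le_one r _

/-- `0 ≤ τ^{ε} ≤ 1/(2r+1)`. [folklore] -/
theorem tauQ_nonneg (neg : Bool) (t : ℤ) : 0 ≤ tauQ r neg t := by
  unfold tauQ; split_ifs <;> exact tauC_nonneg r _
/-- `τ^{ε} ≤ 1/(2r+1)`. [folklore] -/
theorem tauQ_le (neg : Bool) (t : ℤ) : tauQ r neg t ≤ ((2 * (r : ℝ) + 1))⁻¹ := by
  unfold tauQ; split_ifs <;> exact tauC_le r _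

/-- `τ^{ε}(t) ≠ 0 ⇒ |t| ≤ 2r`, and `t ≥ 0` (`neg = false`) ∕ `t ≤ 0` (`neg = true`). [folklore] -/
theorem tauQ_window {neg : Bool} {t : ℤ} (h : tauQ r neg t ≠ 0) : |t| ≤ 2 * (r : ℤ) ∧ (neg = false → 0 ≤ t) ∧ (neg = true → t ≤ 0) := by
  cases neg
  · simp only [tauQ, Bool.false_eq_true, ↓reduceIte] at h
    by_cases hw : 0 ≤ t ∧ t ≤ 2 * (r : ℤ)
    · exact ⟨abs_le.mpr ⟨by omega, hw.2⟩, fun _ => hw.1, fun h' => by simp at h'⟩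
    · exact absurd (tauC_eq_zero r (by omega)) h
  · simp only [tauQ, ↓reduceIte] at h
    by_cases hw : 0 ≤ -t ∧ -t ≤ 2 * (r : ℤ)
    · exact ⟨abs_le.mpr ⟨by omega, by omega⟩, fun h' => by simp at h', fun _ => by omega⟩
    · exact absurd (tauC_eq_zero r (by omega)) h

/-- `h^{ε}(t) ≠ 0 ⇒ |t| ≤ 2r`, and `1 ≤ t` (`neg = false`) ∕ `t ≤ 0` (`neg = true`). [folklore] -/
theorem hstepQ_window {neg : Bool} {t : ℤ} (h : hstepQ r neg t ≠ 0) : |t| ≤ 2 * (r : ℤ) ∧ (neg = false → 1 ≤ t) ∧ (neg = true → t ≤ 0) := by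
  cases neg
  · simp only [hstepQ, Bool.false_eq_true, ↓reduceIte] at h
    by_cases hw : 1 ≤ t ∧ t ≤ 2 * (r : ℤ)
    · exact ⟨abs_le.mpr ⟨by omega, hw.2⟩, fun _ => hw.1, fun h' => by simp at h'⟩
    · exfalso; apply h
      rcases not_and_or.mp hw with h1 | h2
      · exact hstepC_eq_zero_of_le r (by omega)
      · exact hstepC_eq_zero_of_lt r (by omega)
  · simp only [hstepQ, ↓reduceIte, ne_eq, neg_eq_zero] at h
    by_cases hw : 1 ≤ 1 - t ∧ 1 - t ≤ 2 * (r : ℤ)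
    · exact ⟨abs_le.mpr ⟨by omega, by omega⟩, fun h' => by simp at h', fun _ => by omega⟩
    · exfalso; apply h
      rcases not_and_or.mp hw with h1 | h2
      · exact hstepC_eq_zero_of_le r (by omega)
      · exact hstepC_eq_zero_of_lt r (by omega)

/-! ## §3 The quadrant-anchored profile on `ℤ²` -/

variable (negμ negν : Bool)

/-- `β_X(x, y) = −τ^{ε_μ}(x)·h^{ε_ν}(y)`. [folklore] -/
def betaQX (x y : ℤ) : ℝ := -(tauQ r negμ x * hstepQ r negν y)

/-- `β_Y(x, y) = h^{ε_μ}(x)·δ₀(y)` (independent of the `ν`-sign). [folklore] -/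
def betaQY (x y : ℤ) : ℝ := hstepQ r negμ x * delta0 y

/-- `ρ_Q(x, y) = τ^{ε_μ}(x)·τ^{ε_ν}(y)` — the spread density on the quadrant window. [folklore] -/
def rhoQ (x y : ℤ) : ℝ := tauQ r negμ x * tauQ r negν y
/-- **★ `curl β_Q = δ₀⊗δ₀ − ρ_Q`** (all four quadrants): `β_X(x,y) + β_Y(x+1,y) − β_X(x,y+1) − β_Y(x,y) = δ₀(x)δ₀(y) − ρ_Q(x,y)`. [folklore] -/
theorem curl_betaQ (x y : ℤ) :
    betaQX r negμ negν x y + betaQY r negμ (x + 1) y - betaQX r negμ negν x (y + 1) - betaQY r negμ x y = delta0 x * delta0 y - rhoQ r negμ negν x y := by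
  have hx := hstepQ_succ_sub r negμ x
  have hy := hstepQ_succ_sub r negν y
  unfold betaQX betaQY rhoQ
  linear_combination (delta0 y) * hx + (tauQ r negμ x) * hy

/-- `|β_X| ≤ 1/(2r+1)`. [folklore] -/
theorem abs_betaQX_le (x y : ℤ) : |betaQX r negμ negν x y| ≤ ((2 * (r : ℝ) + 1))⁻¹ := by
  unfold betaQX
  rw [abs_neg, abs_mul, abs_of_nonneg (tauQ_nonneg r negμ x)]
  calc tauQ r negμ x * |hstepQ r negν y| ≤ ((2 * (r : ℝ) + 1))⁻¹ * 1 :=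
        mul_le_mul (tauQ_le r negμ x) (abs_hstepQ_le_one r negν y) (abs_nonneg _) (inv_nonneg.mpr (n_pos r).le)
    _ = ((2 * (r : ℝ) + 1))⁻¹ := mul_one _

/-- `|β_Y| ≤ 1`. [folklore] -/
theorem abs_betaQY_le (x y : ℤ) : |betaQY r negμ x y| ≤ 1 := by
  unfold betaQY delta0
  rw [abs_mul]
  split_ifs
  · rw [abs_one, mul_one]; exact abs_hstepQ_le_one r negμ x
  · simp

/-- `0 ≤ ρ_Q`. [folklore] -/
theorem rhoQ_nonneg (x y : ℤ) : 0 ≤ rhoQ r negμ negν x y := mul_nonneg (tauQ_nonneg r negμ x) (tauQ_nonneg r negν y)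

/-- `ρ_Q ≤ 1/(2r+1)²`. [folklore] -/
theorem rhoQ_le (x y : ℤ) : rhoQ r negμ negν x y ≤ ((2 * (r : ℝ) + 1))⁻¹ ^ 2 := by
  unfold rhoQ; rw [sq]
  exact mul_le_mul (tauQ_le r negμ x) (tauQ_le r negν y) (tauQ_nonneg r negν y) (inv_nonneg.mpr (n_pos r).le)

/-! ## §4 The quadrant-anchored model 1-forms and the LEAD's `betaC` -/

section Model

variable {d : ℕ} (μ ν : Fin d)

/-- **THE QUADRANT-ANCHORED TUBE PROFILE AS A MODEL 1-FORM** (signs `negμ`, `negν` pick the quadrant: `false` = the `≥ 1` side, `true` = the `≤ 0` side). [folklore] -/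
def betaQB (u : Fin d → ℤ) (κ : Fin d) : ℝ :=
  if κ = μ then betaQX r negμ negν (u μ) (u ν) else if κ = ν then betaQY r negμ (u μ) (u ν) else 0

/-- **THE LEAD's `betaC`**: the profile anchored at `Q₃ = {u_μ ≥ 1, u_ν ≥ 1}` (window `[0, 2r]²`, δ at the corner `(0,0)`). [folklore] -/
def betaC (u : Fin d → ℤ) (κ : Fin d) : ℝ := betaQB r false false μ ν u κ

/-- On `μ`-bonds `β_Q = β_X`. [folklore] -/
theorem betaQB_apply_fst (u : Fin d → ℤ) : betaQB r negμ negν μ ν u μ = betaQX r negμ negν (u μ) (u ν) := by simp [betaQB]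

/-- On `ν`-bonds (`ν ≠ μ`) `β_Q = β_Y`. [folklore] -/
theorem betaQB_apply_snd (hμν : μ ≠ ν) (u : Fin d → ℤ) : betaQB r negμ negν μ ν u ν = betaQY r negμ (u μ) (u ν) := by
  simp [betaQB, hμν.symm]

/-- On longitudinal bonds `β_Q = 0`. [folklore] -/
theorem betaQB_of_ne {κ : Fin d} (hκμ : κ ≠ μ) (hκν : κ ≠ ν) (u : Fin d → ℤ) : betaQB r negμ negν μ ν u κ = 0 := by simp [betaQB, hκμ, hκν]

/-- `β_Q` is invariant under longitudinal translations. [folklore] -/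
theorem betaQB_add_e_of_ne {κ : Fin d} (hκμ : κ ≠ μ) (hκν : κ ≠ ν) (u : Fin d → ℤ) (α : Fin d) :
    betaQB r negμ negν μ ν (u + e κ) α = betaQB r negμ negν μ ν u α := by
  simp only [betaQB, add_e_apply_ne _ hκμ.symm, add_e_apply_ne _ hκν.symm]

/-- **★ `curlB β_Q (u; μ, ν) = δ₀(u_μ)δ₀(u_ν) − ρ_Q(u_μ, u_ν)`.** [folklore] -/
theorem curlB_betaQB (hμν : μ ≠ ν) (u : Fin d → ℤ) :
    curlB (betaQB r negμ negν μ ν) u μ ν = delta0 (u μ) * delta0 (u ν) - rhoQ r negμ negν (u μ) (u ν) := by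
  rw [curlB_def, betaQB_apply_fst, betaQB_apply_fst, betaQB_apply_snd r negμ negν μ ν hμν, betaQB_apply_snd r negμ negν μ ν hμν, add_e_apply_same,
    add_e_apply_ne _ hμν, add_e_apply_ne _ (Ne.symm hμν), add_e_apply_same]
  exact curl_betaQ r negμ negν (u μ) (u ν)

/-- Longitudinal plaquettes see no curl of `β_Q`. [folklore] -/
theorem curlB_betaQB_longitudinal {κ : Fin d} (hκμ : κ ≠ μ) (hκν : κ ≠ ν) (u : Fin d → ℤ) (α : Fin d) :
    curlB (betaQB r negμ negν μ ν) u α κ = 0 ∧ curlB (betaQB r negμ negν μ ν) u κ α = 0 :=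
  curlB_eq_zero_of_longitudinal _ κ (fun v => betaQB_of_ne r negμ negν μ ν hκμ hκν v) (fun v β => betaQB_add_e_of_ne r negμ negν μ ν hκμ hκν v β) u α

/-- **★★ `curlB (s + β_Q) (u; μ, ν) = −ρ_Q(u_μ, u_ν)`** — same sign convention `t = s + β` for all four quadrants. [folklore] -/
theorem curlB_stringInd_add_betaQB (hμν : μ ≠ ν) (u : Fin d → ℤ) :
    curlB (stringInd μ ν + betaQB r negμ negν μ ν) u μ ν = -rhoQ r negμ negν (u μ) (u ν) := by
  rw [curlB_add, curlB_stringInd μ ν hμν, curlB_betaQB r negμ negν μ ν hμν]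
  unfold delta0
  by_cases h0 : u μ = 0
  · by_cases h1 : u ν = 0
    · rw [if_pos ⟨h0, h1⟩, if_pos h0, if_pos h1]; ring
    · rw [if_neg (fun h => h1 h.2), if_pos h0, if_neg h1]; ring
  · rw [if_neg (fun h => h0 h.1), if_neg h0]; ring

/-- Longitudinal plaquettes see no curl of `s + β_Q`. [folklore] -/
theorem curlB_stringInd_add_betaQB_longitudinal {κ : Fin d} (hκμ : κ ≠ μ) (hκν : κ ≠ ν) (u : Fin d → ℤ) (α : Fin d) :
    curlB (stringInd μ ν + betaQB r negμ negν μ ν) u α κ = 0 ∧ curlB (stringInd μ ν + betaQB r negμ negν μ ν) u κ α = 0 := by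
  have hs := curlB_eq_zero_of_longitudinal (stringInd μ ν) κ (fun v => stringInd_of_ne μ ν hκμ v) (fun v β => stringInd_add_e_of_ne μ ν hκμ hκν v β) u α
  have hb := curlB_betaQB_longitudinal r negμ negν μ ν hκμ hκν u α
  refine ⟨?_, ?_⟩
  · rw [curlB_add, hs.1, hb.1, add_zero]
  · rw [curlB_add, hs.2, hb.2, add_zero]

/-- `|curlB (s + β_Q) (u; μ, ν)| ≤ 1/(2r+1)²`. [folklore] -/
theorem abs_curlB_stringInd_add_betaQB_le (hμν : μ ≠ ν) (u : Fin d → ℤ) :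
    |curlB (stringInd μ ν + betaQB r negμ negν μ ν) u μ ν| ≤ ((2 * (r : ℝ) + 1))⁻¹ ^ 2 := by
  rw [curlB_stringInd_add_betaQB r negμ negν μ ν hμν, abs_neg, abs_of_nonneg (rhoQ_nonneg r negμ negν _ _)]
  exact rhoQ_le r negμ negν _ _

/-- `|β_Q| ≤ 1` on every bond (`≤ 1/(2r+1)` on `μ`-bonds: `abs_betaQX_le`). [folklore] -/
theorem abs_betaQB_le (u : Fin d → ℤ) (κ : Fin d) : |betaQB r negμ negν μ ν u κ| ≤ 1 := by
  unfold betaQB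
  split_ifs
  · exact (abs_betaQX_le r negμ negν _ _).trans (inv_le_one_of_one_le₀ (by linarith [Nat.cast_nonneg (α := ℝ) r]))
  · exact abs_betaQY_le r negμ _ _
  · simp

/-- **★ EVERY MODIFIED BOND TOUCHES THE ANCHORING QUADRANT** `Q(negμ, negν) = {u_μ ≤ 0 if negμ else 1 ≤ u_μ} ∩ {u_ν ≤ 0 if negν else 1 ≤ u_ν}`: if `β_Q(u, κ) ≠ 0` then `κ ∈ {μ, ν}` and
`u` or `u + e_κ` lies in `Q(negμ, negν)`. [folklore] -/
theorem betaQB_touches (hμν : μ ≠ ν) {u : Fin d → ℤ} {κ : Fin d} (h : betaQB r negμ negν μ ν u κ ≠ 0) :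
    (κ = μ ∨ κ = ν) ∧
      (((if negμ then u μ ≤ 0 else 1 ≤ u μ) ∧ (if negν then u ν ≤ 0 else 1 ≤ u ν)) ∨
        ((if negμ then (u + e κ) μ ≤ 0 else 1 ≤ (u + e κ) μ) ∧ (if negν then (u + e κ) ν ≤ 0 else 1 ≤ (u + e κ) ν))) := by
  unfold betaQB at h
  split_ifs at h with hκμ hκν
  · rw [hκμ]
    unfold betaQX at h
    rw [ne_eq, neg_eq_zero, mul_eq_zero, not_or] at h
    obtain ⟨_, hx0, hx1⟩ := tauQ_window r h.1
    obtain ⟨_, hy0, hy1⟩ := hstepQ_window r h.2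
    refine ⟨Or.inl rfl, ?_⟩
    cases negμ <;> cases negν <;> simp only [Bool.false_eq_true, ↓reduceIte, add_e_apply_same, add_e_apply_ne _ (Ne.symm hμν), forall_const] at hx0 hx1 hy0 hy1 ⊢ <;> omega
  · rw [hκν]
    unfold betaQY delta0 at h
    rw [ne_eq, mul_eq_zero, not_or] at h
    obtain ⟨_, hx0, hx1⟩ := hstepQ_window r h.1
    have hy : u ν = 0 := by by_contra hy; exact h.2 (if_neg hy)
    refine ⟨Or.inr rfl, ?_⟩
    cases negμ <;> cases negν <;> simp only [Bool.false_eq_true, ↓reduceIte, add_e_apply_same, add_e_apply_ne _ hμν, forall_const] at hx0 hx1 ⊢ <;> omega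
  · exact absurd rfl h

/-- **THE WINDOW OF THE MODIFIED BONDS**: `β_Q(u, κ) ≠ 0 ⇒ |u_μ| ≤ 2r ∧ |u_ν| ≤ 2r`. [folklore] -/
theorem betaQB_window {u : Fin d → ℤ} {κ : Fin d} (h : betaQB r negμ negν μ ν u κ ≠ 0) : |u μ| ≤ 2 * (r : ℤ) ∧ |u ν| ≤ 2 * (r : ℤ) := by
  unfold betaQB at h
  split_ifs at h with hκμ hκν
  · unfold betaQX at h
    rw [ne_eq, neg_eq_zero, mul_eq_zero, not_or] at h
    exact ⟨(tauQ_window r h.1).1, (hstepQ_window r h.2).1⟩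
  · unfold betaQY delta0 at h
    rw [ne_eq, mul_eq_zero, not_or] at h
    have hy : u ν = 0 := by by_contra hy; exact h.2 (if_neg hy)
    exact ⟨(hstepQ_window r h.1).1, by rw [hy, abs_zero]; positivity⟩
  · exact absurd rfl h

/-- `betaC` IS the `(false, false)` member. [folklore] -/
theorem betaC_eq : betaC r μ ν = betaQB r false false μ ν := rfl
/-- **★★ `curlB (s + β_C) (u; μ, ν) = −τ_C(u_μ)·τ_C(u_ν)`** (the LEAD's corner-anchored tube form). [folklore] -/
theorem curlB_stringInd_add_betaC (hμν : μ ≠ ν) (u : Fin d → ℤ) :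
    curlB (stringInd μ ν + betaC r μ ν) u μ ν = -(tauC r (u μ) * tauC r (u ν)) := by
  rw [betaC_eq, curlB_stringInd_add_betaQB r false false μ ν hμν]
  simp [rhoQ, tauQ]

/-- `|curlB (s + β_C)| ≤ 1/(2r+1)²` on transverse plaquettes; longitudinal ones are `0` (`curlB_stringInd_add_betaQB_longitudinal` at `(false,false)`). [folklore] -/
theorem abs_curlB_stringInd_add_betaC_le (hμν : μ ≠ ν) (u : Fin d → ℤ) : |curlB (stringInd μ ν + betaC r μ ν) u μ ν| ≤ ((2 * (r : ℝ) + 1))⁻¹ ^ 2 :=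
  abs_curlB_stringInd_add_betaQB_le r false false μ ν hμν u

/-- **★ EVERY BOND MODIFIED BY `β_C` TOUCHES `Q₃ = {u_μ ≥ 1, u_ν ≥ 1}`.** [folklore] -/
theorem betaC_touches_Q3 (hμν : μ ≠ ν) {u : Fin d → ℤ} {κ : Fin d} (h : betaC r μ ν u κ ≠ 0) :
    (κ = μ ∨ κ = ν) ∧ ((1 ≤ u μ ∧ 1 ≤ u ν) ∨ (1 ≤ (u + e κ) μ ∧ 1 ≤ (u + e κ) ν)) := by
  have h' := betaQB_touches r false false μ ν hμν h
  simpa only [Bool.false_eq_true, ↓reduceIte] using h'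

/-- The window of `β_C`: `|u_μ|, |u_ν| ≤ 2r` on modified bonds (indeed `0 ≤ u_μ, u_ν`). [folklore] -/
theorem betaC_window {u : Fin d → ℤ} {κ : Fin d} (h : betaC r μ ν u κ ≠ 0) : |u μ| ≤ 2 * (r : ℤ) ∧ |u ν| ≤ 2 * (r : ℤ) :=
  betaQB_window r false false μ ν h

end Model

/-! ## §5 The plaquettes of the quadrant-anchored tube field -/

section Tube

variable {d : ℕ} (μ ν : Fin d) {n : Type*} [Fintype n] [DecidableEq n] [Nonempty n] (V₁₂ V₂₃ V₁₄ : Matrix.specialUnitaryGroup n ℂ) (F' : lieSU n)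

/-- **★ TRANSVERSE PLAQUETTES OF `U_{s+β_Q}` ARE WITHIN `exp(‖F′‖/(2r+1)²) − 1` OF `1`** (all four quadrants; `betaC` = `(false,false)`). [cite: Balaban1985Averaging, (8) p.18] -/
theorem dist1_plaqB_tubeU_stringInd_add_betaQB_le (hμν : μ ≠ ν) (u : Fin d → ℤ) :
    GaugeGroup.dist1 (plaqB (tubeU μ ν V₁₂ V₂₃ V₁₄ F' (stringInd μ ν + betaQB r negμ negν μ ν)) u μ ν) ≤
      Real.exp (((2 * (r : ℝ) + 1))⁻¹ ^ 2 * ‖(F' : Matrix n n ℂ)‖) - 1 := by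
  refine (dist1_plaqB_tubeU_le μ ν V₁₂ V₂₃ V₁₄ F' _ u μ ν).trans ?_
  gcongr
  exact abs_curlB_stringInd_add_betaQB_le r negμ negν μ ν hμν u

omit [Nonempty n] in
/-- Longitudinal plaquettes of `U_{s+β_Q}` ARE `1`. [cite: Balaban1985Averaging, (8) p.18] -/
theorem plaqB_tubeU_stringInd_add_betaQB_eq_one {κ : Fin d} (hκμ : κ ≠ μ) (hκν : κ ≠ ν) (u : Fin d → ℤ) (α : Fin d) :
    plaqB (tubeU μ ν V₁₂ V₂₃ V₁₄ F' (stringInd μ ν + betaQB r negμ negν μ ν)) u α κ = 1 ∧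
      plaqB (tubeU μ ν V₁₂ V₂₃ V₁₄ F' (stringInd μ ν + betaQB r negμ negν μ ν)) u κ α = 1 := by
  have h := curlB_stringInd_add_betaQB_longitudinal r negμ negν μ ν hκμ hκν u α
  exact ⟨plaqB_tubeU_eq_one μ ν V₁₂ V₂₃ V₁₄ F' _ u α κ h.1, plaqB_tubeU_eq_one μ ν V₁₂ V₂₃ V₁₄ F' _ u κ α h.2⟩

end Tube

end Summit.QuantumFields.YangMills.Theorems.TubeProfile

end
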